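import Mathlib
import HarnessLib
import Summits.Ventures.LatticeQCDFlow.Exactness.SU2ExactForceVolumeUniform
import Summits.Ventures.LatticeQCDFlow.Exactness.SU2WilsonFlowLOAcceptanceLattice

/-!
# One trajectory-length threshold for every volume: UNIQUENESS of the invariant law, and the row's 4-d PARITY-MASKED acceptance family (Lüscher's schedule) on EVERY even torus

HONEST FRAMING: exact (Metropolis-corrected) sampling algorithms for lattice gauge theory;
figures of merit are autocorrelation/cost numbers at stated couplings and volumes; no
continuum-physics claim.

Venture `LatticeQCDFlow` (cell pub-lqcd), topic `Exactness`; FANOUT row 14 (`eng-flowhmc`, engine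
`latflow.fthmc`, family B: FT-HMC through the LO Wilson-flow member on `SU(2)` with the exact autodiff
force; the row's acceptance configuration is 4⁴ `SU(2)`, parity masks, Lüscher's sweep schedule).  NEW
WORK of the cell over the tree (`SU2ExactForceVolumeUniform`: `Φ_max, K_Φ` uniform in the volume and ONE
`τ₀` for the convergence of the `n`-step kernel on every torus; `SUNMultiStepLeapfrogFTHMCErgodic`
(GEN-14): `su2LeapfrogFTHMCN_invariant_unique`; `SU2WilsonFlowLOAcceptanceLattice`: Lüscher's schedule
`(μ, 0), (μ, 1)` over the four directions, `8·nsweeps` sub-steps; `SU2WilsonFlowLOMemberFTHMCN` (GEN-14):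
the member package); nothing is cited as a fact; no number.  Tenth file of the VOLUME-UNIFORMITY chain
(GEN-15): two corollaries of the ninth.

* §1 **`su2LeapfrogFTHMCN_invariant_unique_of_trajLength_uniform`** (threshold before the link set) and
  **`wilsonMeasure_unique_invariant_su2WilsonFlowLO_member_fthmcN_exactForce_allVolumes`** — with the
  SAME kind of volume-free `τ₀`: for every side `L` with `w ∣ L`, every `n ≥ 1`, `ε' > 0`, `nε' ≤ τ₀`,
  `wilsonMeasure SU(2).subtype β` is the ONLY invariant probability law of the reported `n`-step kernel
  with the exact force as run;
* §2 **`su2_fthmcN_parityLattice_exactForce_uniformlyErgodic_allEvenSides`** — any dimension `d`,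
  parity masks (`w = 2`), Lüscher's schedule with `nsweeps` sweeps (`2d·nsweeps` layers: `(μ, 0), (μ, 1)`
  over the directions), refusal rule `2(d−1)|ε| < 1`, every `β, κ, κ' > 0`: ONE `τ₀ > 0` such that on
  EVERY even torus `L^d` the reported `n`-step FT-HMC kernel with the exact force as run converges to the
  Wilson measure from every start whenever `nε' ≤ τ₀` — the row's 4⁴ acceptance configuration (GEN-14
  `su2_fthmcN_acceptanceLattice_exactForce_uniformlyErgodic`, `d = 4`, `6|ε| < 1`) and every larger even
  volume share the threshold.

NOT CLAIMED: the value of `τ₀`; volume-uniformity of the rate; odd sides (no parity mask); long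
trajectories; OMF; floating point; any number.
-/

noncomputable section

namespace Summit.Ventures.LatticeQCDFlow.Exactness

open Set Function MeasureTheory ProbabilityTheory ProbabilityTheory.Kernel InnerProductGeometry WithLp NormedSpace
open Literature.MathematicalPhysics.QuantumFieldTheory
open Literature.MathematicalPhysics.QuantumFieldTheory.Balaban1983to89.B10Eq18SigmaSU2Haar (expPauli)
open scoped ENNReal Matrix Matrix.Norms.Operator NNReal

set_option backward.isDefEq.respectTransparency false

/-! ## §1 Uniqueness of the invariant law, threshold before the link set -/

section Unique

variable {d : ℕ}

/-- **Uniqueness in trajectory-length form, threshold first**: for `κ > 0`, `Φ_max, K_Φ ≥ 0` there is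
`τ₀ > 0` such that for EVERY finite link set, every measurable force field bounded by `Φ_max` and
`K_Φ`-Lipschitz, every measurable bounded action, every member with pinched measurable Jacobian and every
`n ≥ 1`, `ε > 0` with `nε ≤ τ₀`, `su2GibbsLaw S` is the ONLY invariant probability law of the reported
`n`-step kernel. -/
theorem su2LeapfrogFTHMCN_invariant_unique_of_trajLength_uniform {κ Φmax KΦ : ℝ} (hκ : 0 < κ)
    (hΦ0 : 0 ≤ Φmax) (hKΦ0 : 0 ≤ KΦ) :
    ∃ τ₀ : ℝ, 0 < τ₀ ∧ ∀ (ι : Type) [Fintype ι]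
      {Φ : (ι → Matrix.specialUnitaryGroup (Fin 2) ℂ) → ι → EuclideanSpace ℝ (Fin 3)} (hΦ : Measurable Φ)
      (_hΦb : ∀ U l, ‖Φ U l‖ ≤ Φmax) (_hΦK : ∀ U U', ‖Φ U - Φ U'‖ ≤ KΦ * ‖coeConfig U - coeConfig U'‖)
      {S : (ι → Matrix.specialUnitaryGroup (Fin 2) ℂ) → ℝ} (_hS : Measurable S) {s : ℝ} (_hs : ∀ u, |S u| ≤ s)
      {J : (ι → Matrix.specialUnitaryGroup (Fin 2) ℂ) → ℝ} {j₁ j₂ : ℝ} (_hj₁ : 0 < j₁) (_hJ₁ : ∀ v, j₁ ≤ J v)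
      (_hJ₂ : ∀ v, J v ≤ j₂) (_hJm : Measurable J)
      {F : (ι → Matrix.specialUnitaryGroup (Fin 2) ℂ) ≃ᵐ (ι → Matrix.specialUnitaryGroup (Fin 2) ℂ)}
      (_hF : HasJacobian (Measure.pi fun _ : ι => haarProbability (Matrix.specialUnitaryGroup (Fin 2) ℂ)) F
        fun v => ENNReal.ofReal (J v))
      (n : ℕ) (ε : ℝ) (_hn : 1 ≤ n) (_hε : 0 < ε), n * ε ≤ τ₀ →
      ∀ (π' : Measure (ι → Matrix.specialUnitaryGroup (Fin 2) ℂ)) [IsProbabilityMeasure π'],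
        Invariant (conjKernel (su2LeapfrogHMCN ε κ (measurable_halfKick_su2 hΦ ε)
          (fun v => S (F v) - Real.log (J v)) n) F) π' → π' = su2GibbsLaw S := by
  set s₀ := sunShortTrajThreshold pauliCoordι pauliCoordι_injective with hs₀
  have hs₀0 : 0 < s₀ := sunShortTrajThreshold_pos _ _
  refine ⟨min s₀ (min (s₀ / (3 * Φmax + 1)) (Real.sqrt (s₀ / (KΦ + 1)))),
    lt_min hs₀0 (lt_min (by positivity) (Real.sqrt_pos.2 (by positivity))), ?_⟩
  intro ι _ Φ hΦ hΦb hΦK S hS s hs J j₁ j₂ hj₁ hJ₁ hJ₂ hJm F hF n ε hn hε hτ π' _ hπ'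
  obtain ⟨h1, h2, h3⟩ := trajLength_threshold_arith hs₀0 hΦ0 hKΦ0 hn hε rfl hτ
  refine su2LeapfrogFTHMCN_invariant_unique hε hκ hn (measurable_halfKick_su2 hΦ ε) (b := ε / 2 * Φmax)
    (Kg := ε / 2 * KΦ) (by positivity) (fun U l => ?_) (by positivity) (fun U U' => ?_) hS hs hj₁ hJ₁ hJ₂ hJm hF h1 h2 h3 hπ'
  · rw [Pi.smul_apply, norm_smul, Real.norm_eq_abs, abs_neg, abs_of_pos (by positivity)]
    exact mul_le_mul_of_nonneg_left (hΦb U l) (by positivity)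
  · have hsub : (-(ε / 2)) • Φ U - (-(ε / 2)) • Φ U' = (-(ε / 2)) • (Φ U - Φ U') := by
      funext l; simp only [Pi.sub_apply, Pi.smul_apply, smul_sub]
    rw [hsub, norm_smul, Real.norm_eq_abs, abs_neg, abs_of_pos (by positivity), mul_assoc]
    exact mul_le_mul_of_nonneg_left (hΦK U U') (by positivity)

/-- **THE WILSON MEASURE IS THE UNIQUE INVARIANT LAW, ONE THRESHOLD FOR EVERY VOLUME.**  Phase masks
of width `w > 1`, `2(d−1)|ε| < 1`, ANY schedule, every `β, κ, κ' > 0`: there is `τ₀ > 0` such that for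
EVERY side `L` with `w ∣ L` there are `layers` (VERBATIM) with measurable exact force, and for every
`n ≥ 1`, `ε' > 0`, `nε' ≤ τ₀`, `wilsonMeasure SU(2).subtype β` is the ONLY invariant probability law of the
reported `n`-step kernel with the exact force as run. -/
theorem wilsonMeasure_unique_invariant_su2WilsonFlowLO_member_fthmcN_exactForce_allVolumes (w : ℕ) [Fact (1 < w)]
    {ε : ℝ} (hε : |ε| * (2 * ((d - 1 : ℕ) : ℝ)) < 1) (sched : List (Fin d × ZMod w)) (β κ : ℝ)
    {κ' : ℝ} (hκ' : 0 < κ') :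
    ∃ τ₀ : ℝ, 0 < τ₀ ∧ ∀ (L : ℕ) [NeZero L] (hwL : w ∣ L),
    ∃ layers : List ((GaugeConfig d L (Matrix.specialUnitaryGroup (Fin 2) ℂ) ≃ᵐ GaugeConfig d L (Matrix.specialUnitaryGroup (Fin 2) ℂ)) × (GaugeConfig d L (Matrix.specialUnitaryGroup (Fin 2) ℂ) → ℝ)),
      layers.map (fun Ly => ((Ly.1 : GaugeConfig d L (Matrix.specialUnitaryGroup (Fin 2) ℂ) → GaugeConfig d L (Matrix.specialUnitaryGroup (Fin 2) ℂ)), Ly.2)) =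
        sched.map (fun s =>
        ((fun (V : GaugeConfig d L (Matrix.specialUnitaryGroup (Fin 2) ℂ)) (e : Edge d L) =>
        if e.2 = s.1 ∧ (ZMod.castHom hwL (ZMod w) (∑ j, e.1 j)) = s.2 then
          gaussUnit (geodesicKick ε (∑ ν ∈ Finset.univ.erase e.2,
            (vecQuat (((V (Site.shift e.1 e.2, ν) * (V (Site.shift e.1 ν, e.2))⁻¹ * (V (e.1, ν))⁻¹)⁻¹ : (Matrix.specialUnitaryGroup (Fin 2) ℂ)) : Matrix (Fin 2) (Fin 2) ℂ) +
              vecQuat ((((V (Site.shift (e.1 - Pi.single ν 1) e.2, ν))⁻¹ * (V (e.1 - Pi.single ν 1, e.2))⁻¹ *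
                V (e.1 - Pi.single ν 1, ν))⁻¹ : (Matrix.specialUnitaryGroup (Fin 2) ℂ)) : Matrix (Fin 2) (Fin 2) ℂ)))
            (vecQuat ((V e : (Matrix.specialUnitaryGroup (Fin 2) ℂ)) : Matrix (Fin 2) (Fin 2) ℂ)))
        else V e),
         fun V : GaugeConfig d L (Matrix.specialUnitaryGroup (Fin 2) ℂ) => ∏ a : {e : Edge d L // e.2 = s.1 ∧ (ZMod.castHom hwL (ZMod w) (∑ j, e.1 j)) = s.2},
          (if Real.sin (angle (∑ ν ∈ Finset.univ.erase a.1.2,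
            (vecQuat (((V (Site.shift a.1.1 a.1.2, ν) * (V (Site.shift a.1.1 ν, a.1.2))⁻¹ * (V (a.1.1, ν))⁻¹)⁻¹ : (Matrix.specialUnitaryGroup (Fin 2) ℂ)) : Matrix (Fin 2) (Fin 2) ℂ) +
              vecQuat ((((V (Site.shift (a.1.1 - Pi.single ν 1) a.1.2, ν))⁻¹ * (V (a.1.1 - Pi.single ν 1, a.1.2))⁻¹ *
                V (a.1.1 - Pi.single ν 1, ν))⁻¹ : (Matrix.specialUnitaryGroup (Fin 2) ℂ)) : Matrix (Fin 2) (Fin 2) ℂ))) (vecQuat ((V a.1 : (Matrix.specialUnitaryGroup (Fin 2) ℂ)) : Matrix (Fin 2) (Fin 2) ℂ))) = 0 then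
            (1 - ε * ‖(∑ ν ∈ Finset.univ.erase a.1.2,
            (vecQuat (((V (Site.shift a.1.1 a.1.2, ν) * (V (Site.shift a.1.1 ν, a.1.2))⁻¹ * (V (a.1.1, ν))⁻¹)⁻¹ : (Matrix.specialUnitaryGroup (Fin 2) ℂ)) : Matrix (Fin 2) (Fin 2) ℂ) +
              vecQuat ((((V (Site.shift (a.1.1 - Pi.single ν 1) a.1.2, ν))⁻¹ * (V (a.1.1 - Pi.single ν 1, a.1.2))⁻¹ *
                V (a.1.1 - Pi.single ν 1, ν))⁻¹ : (Matrix.specialUnitaryGroup (Fin 2) ℂ)) : Matrix (Fin 2) (Fin 2) ℂ)))‖ * Real.cos (angle (∑ ν ∈ Finset.univ.erase a.1.2,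
            (vecQuat (((V (Site.shift a.1.1 a.1.2, ν) * (V (Site.shift a.1.1 ν, a.1.2))⁻¹ * (V (a.1.1, ν))⁻¹)⁻¹ : (Matrix.specialUnitaryGroup (Fin 2) ℂ)) : Matrix (Fin 2) (Fin 2) ℂ) +
              vecQuat ((((V (Site.shift (a.1.1 - Pi.single ν 1) a.1.2, ν))⁻¹ * (V (a.1.1 - Pi.single ν 1, a.1.2))⁻¹ *
                V (a.1.1 - Pi.single ν 1, ν))⁻¹ : (Matrix.specialUnitaryGroup (Fin 2) ℂ)) : Matrix (Fin 2) (Fin 2) ℂ))) (vecQuat ((V a.1 : (Matrix.specialUnitaryGroup (Fin 2) ℂ)) : Matrix (Fin 2) (Fin 2) ℂ)))) ^ 3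
          else kickJac (ε * ‖(∑ ν ∈ Finset.univ.erase a.1.2,
            (vecQuat (((V (Site.shift a.1.1 a.1.2, ν) * (V (Site.shift a.1.1 ν, a.1.2))⁻¹ * (V (a.1.1, ν))⁻¹)⁻¹ : (Matrix.specialUnitaryGroup (Fin 2) ℂ)) : Matrix (Fin 2) (Fin 2) ℂ) +
              vecQuat ((((V (Site.shift (a.1.1 - Pi.single ν 1) a.1.2, ν))⁻¹ * (V (a.1.1 - Pi.single ν 1, a.1.2))⁻¹ *
                V (a.1.1 - Pi.single ν 1, ν))⁻¹ : (Matrix.specialUnitaryGroup (Fin 2) ℂ)) : Matrix (Fin 2) (Fin 2) ℂ)))‖) 2 (angle (∑ ν ∈ Finset.univ.erase a.1.2,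
            (vecQuat (((V (Site.shift a.1.1 a.1.2, ν) * (V (Site.shift a.1.1 ν, a.1.2))⁻¹ * (V (a.1.1, ν))⁻¹)⁻¹ : (Matrix.specialUnitaryGroup (Fin 2) ℂ)) : Matrix (Fin 2) (Fin 2) ℂ) +
              vecQuat ((((V (Site.shift (a.1.1 - Pi.single ν 1) a.1.2, ν))⁻¹ * (V (a.1.1 - Pi.single ν 1, a.1.2))⁻¹ *
                V (a.1.1 - Pi.single ν 1, ν))⁻¹ : (Matrix.specialUnitaryGroup (Fin 2) ℂ)) : Matrix (Fin 2) (Fin 2) ℂ))) (vecQuat ((V a.1 : (Matrix.specialUnitaryGroup (Fin 2) ℂ)) : Matrix (Fin 2) (Fin 2) ℂ)))))) ∧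
      ∃ hΦ : Measurable (fun (V : GaugeConfig d L (Matrix.specialUnitaryGroup (Fin 2) ℂ)) (l : Edge d L) => κ • WithLp.toLp 2 (fun i : Fin 3 =>
        fderiv ℝ (fun a : Edge d L → EuclideanSpace ℝ (Fin 3) => β * wilsonAction (Matrix.specialUnitaryGroup (Fin 2) ℂ).subtype ((layers.foldr (fun Ly (F : GaugeConfig d L (Matrix.specialUnitaryGroup (Fin 2) ℂ) ≃ᵐ GaugeConfig d L (Matrix.specialUnitaryGroup (Fin 2) ℂ)) => Ly.1.trans F) (MeasurableEquiv.refl (GaugeConfig d L (Matrix.specialUnitaryGroup (Fin 2) ℂ)))) ((fun l : Edge d L => expPauli (a l)) * V)) - Real.log ((layers.foldr (fun Ly K => fun v => Ly.2 v * K (Ly.1 v)) (fun _ => (1 : ℝ))) ((fun l : Edge d L => expPauli (a l)) * V))) 0 (Pi.single l (EuclideanSpace.single i (1 : ℝ))))),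
      ∀ (n : ℕ) (ε' : ℝ) (_hn : 1 ≤ n) (_hε' : 0 < ε'), n * ε' ≤ τ₀ →
        ∀ (π' : Measure (GaugeConfig d L (Matrix.specialUnitaryGroup (Fin 2) ℂ))) [IsProbabilityMeasure π'],
          Invariant (conjKernel (su2LeapfrogHMCN ε' κ' (measurable_halfKick_su2 hΦ ε')
            (fun V : GaugeConfig d L (Matrix.specialUnitaryGroup (Fin 2) ℂ) => β * wilsonAction (Matrix.specialUnitaryGroup (Fin 2) ℂ).subtype ((layers.foldr (fun Ly (F : GaugeConfig d L (Matrix.specialUnitaryGroup (Fin 2) ℂ) ≃ᵐ GaugeConfig d L (Matrix.specialUnitaryGroup (Fin 2) ℂ)) => Ly.1.trans F) (MeasurableEquiv.refl (GaugeConfig d L (Matrix.specialUnitaryGroup (Fin 2) ℂ)))) V) - Real.log ((layers.foldr (fun Ly K => fun v => Ly.2 v * K (Ly.1 v)) (fun _ => (1 : ℝ))) V)) n) (layers.foldr (fun Ly (F : GaugeConfig d L (Matrix.specialUnitaryGroup (Fin 2) ℂ) ≃ᵐ GaugeConfig d L (Matrix.specialUnitaryGroup (Fin 2) ℂ)) =>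 Ly.1.trans F) (MeasurableEquiv.refl (GaugeConfig d L (Matrix.specialUnitaryGroup (Fin 2) ℂ))))) π' →
          π' = wilsonMeasure (Matrix.specialUnitaryGroup (Fin 2) ℂ).subtype β := by
  obtain ⟨Φmax, KΦ, hΦ0, hK0, hreg⟩ := su2WilsonFlowLO_exactForce_regular_uniform (d := d) w hε sched β κ
  obtain ⟨τ₀, hτ₀, huniq⟩ := su2LeapfrogFTHMCN_invariant_unique_of_trajLength_uniform hκ' hΦ0 hK0
  refine ⟨τ₀, hτ₀, fun L _ hwL => ?_⟩
  have hχ : ∀ (x : Site d L) (i : Fin d),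
      ZMod.castHom hwL (ZMod w) (∑ j, (Site.shift x i) j) ≠ ZMod.castHom hwL (ZMod w) (∑ j, x j) :=
    fun x i => phaseMask_proper hwL x i
  obtain ⟨layers, hmap, hpos, hfmeas, hfjac, hfold⟩ := su2WilsonFlowLO_member_package
    (fun x : Site d L => ZMod.castHom hwL (ZMod w) (∑ j, x j)) hχ hε sched
  refine ⟨layers, hmap, ?_⟩
  obtain ⟨hΦm, hb, hK⟩ := hreg L hwL layers hmap hpos
  refine ⟨hΦm, fun n ε' hn hε' hτ π' _ hπ' => ?_⟩
  have hm : 0 < 1 - |ε| * (2 * ((d - 1 : ℕ) : ℝ)) := by linarith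
  have hρ : Continuous ⇑((Matrix.specialUnitaryGroup (Fin 2) ℂ).subtype) := continuous_subtype_val
  have hSc : Continuous fun U : GaugeConfig d L (Matrix.specialUnitaryGroup (Fin 2) ℂ) =>
      β * wilsonAction (Matrix.specialUnitaryGroup (Fin 2) ℂ).subtype U :=
    continuous_smul_wilsonAction _ hρ β
  obtain ⟨s, hs⟩ := exists_bound_smul_wilsonAction (d := d) (L := L) (Matrix.specialUnitaryGroup (Fin 2) ℂ).subtype hρ β
  rw [← su2GibbsLaw_eq_wilsonMeasure (d := d) (L := L) (Matrix.specialUnitaryGroup (Fin 2) ℂ).subtype β]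
  exact huniq (Edge d L) hΦm hb hK
    (S := fun U : GaugeConfig d L (Matrix.specialUnitaryGroup (Fin 2) ℂ) =>
      β * wilsonAction (Matrix.specialUnitaryGroup (Fin 2) ℂ).subtype U)
    hSc.measurable hs (pow_pos (pow_pos hm _) _) (fun v => (hfold v).1) (fun v => (hfold v).2) hfmeas hfjac
    n ε' hn hε' hτ π' hπ'

end Unique

/-! ## §2 The 4-d parity-masked family: every even torus shares the threshold -/

section Parity

/-- **THE ROW'S ACCEPTANCE FAMILY ON EVERY EVEN TORUS, ONE THRESHOLD.**  Any dimension `d`, parity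
masks `Σxᵢ mod 2`, Lüscher's sweep schedule (`nsweeps` sweeps = `2d·nsweeps` masked LO sub-steps), refusal
rule `2(d−1)|ε| < 1`, every `β, κ, κ' > 0`: there is `τ₀ > 0` such that for EVERY even side `L` there are `layers`
(VERBATIM, `2d·nsweeps` of them) with measurable exact force, and for every `n ≥ 1`, `ε' > 0` with `nε' ≤ τ₀` the
reported `n`-step FT-HMC kernel with the exact force as run converges to
`wilsonMeasure SU(2).subtype β` from EVERY start, geometrically in total variation. -/
theorem su2_fthmcN_parityLattice_exactForce_uniformlyErgodic_allEvenSides {d : ℕ} {ε : ℝ}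
    (hε : |ε| * (2 * ((d - 1 : ℕ) : ℝ)) < 1) (nsweeps : ℕ) (β κ : ℝ) {κ' : ℝ} (hκ' : 0 < κ') :
    ∃ τ₀ : ℝ, 0 < τ₀ ∧ ∀ (L : ℕ) [NeZero L] (hwL : 2 ∣ L),
    ∃ layers : List ((GaugeConfig d L (Matrix.specialUnitaryGroup (Fin 2) ℂ) ≃ᵐ GaugeConfig d L (Matrix.specialUnitaryGroup (Fin 2) ℂ)) × (GaugeConfig d L (Matrix.specialUnitaryGroup (Fin 2) ℂ) → ℝ)),
      layers.map (fun Ly => ((Ly.1 : GaugeConfig d L (Matrix.specialUnitaryGroup (Fin 2) ℂ) → GaugeConfig d L (Matrix.specialUnitaryGroup (Fin 2) ℂ)), Ly.2)) =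
        ((List.replicate nsweeps ((List.finRange d).flatMap fun μ : Fin d => [(μ, (0 : ZMod 2)), (μ, 1)])).flatten).map (fun s =>
        ((fun (V : GaugeConfig d L (Matrix.specialUnitaryGroup (Fin 2) ℂ)) (e : Edge d L) =>
        if e.2 = s.1 ∧ (ZMod.castHom hwL (ZMod 2) (∑ j, e.1 j)) = s.2 then
          gaussUnit (geodesicKick ε (∑ ν ∈ Finset.univ.erase e.2,
            (vecQuat (((V (Site.shift e.1 e.2, ν) * (V (Site.shift e.1 ν, e.2))⁻¹ * (V (e.1, ν))⁻¹)⁻¹ : (Matrix.specialUnitaryGroup (Fin 2) ℂ)) : Matrix (Fin 2) (Fin 2) ℂ) +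
              vecQuat ((((V (Site.shift (e.1 - Pi.single ν 1) e.2, ν))⁻¹ * (V (e.1 - Pi.single ν 1, e.2))⁻¹ *
                V (e.1 - Pi.single ν 1, ν))⁻¹ : (Matrix.specialUnitaryGroup (Fin 2) ℂ)) : Matrix (Fin 2) (Fin 2) ℂ)))
            (vecQuat ((V e : (Matrix.specialUnitaryGroup (Fin 2) ℂ)) : Matrix (Fin 2) (Fin 2) ℂ)))
        else V e),
         fun V : GaugeConfig d L (Matrix.specialUnitaryGroup (Fin 2) ℂ) => ∏ a : {e : Edge d L // e.2 = s.1 ∧ (ZMod.castHom hwL (ZMod 2) (∑ j, e.1 j)) = s.2},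
          (if Real.sin (angle (∑ ν ∈ Finset.univ.erase a.1.2,
            (vecQuat (((V (Site.shift a.1.1 a.1.2, ν) * (V (Site.shift a.1.1 ν, a.1.2))⁻¹ * (V (a.1.1, ν))⁻¹)⁻¹ : (Matrix.specialUnitaryGroup (Fin 2) ℂ)) : Matrix (Fin 2) (Fin 2) ℂ) +
              vecQuat ((((V (Site.shift (a.1.1 - Pi.single ν 1) a.1.2, ν))⁻¹ * (V (a.1.1 - Pi.single ν 1, a.1.2))⁻¹ *
                V (a.1.1 - Pi.single ν 1, ν))⁻¹ : (Matrix.specialUnitaryGroup (Fin 2) ℂ)) : Matrix (Fin 2) (Fin 2) ℂ))) (vecQuat ((V a.1 : (Matrix.specialUnitaryGroup (Fin 2) ℂ)) : Matrix (Fin 2) (Fin 2) ℂ))) = 0 then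
            (1 - ε * ‖(∑ ν ∈ Finset.univ.erase a.1.2,
            (vecQuat (((V (Site.shift a.1.1 a.1.2, ν) * (V (Site.shift a.1.1 ν, a.1.2))⁻¹ * (V (a.1.1, ν))⁻¹)⁻¹ : (Matrix.specialUnitaryGroup (Fin 2) ℂ)) : Matrix (Fin 2) (Fin 2) ℂ) +
              vecQuat ((((V (Site.shift (a.1.1 - Pi.single ν 1) a.1.2, ν))⁻¹ * (V (a.1.1 - Pi.single ν 1, a.1.2))⁻¹ *
                V (a.1.1 - Pi.single ν 1, ν))⁻¹ : (Matrix.specialUnitaryGroup (Fin 2) ℂ)) : Matrix (Fin 2) (Fin 2) ℂ)))‖ * Real.cos (angle (∑ ν ∈ Finset.univ.erase a.1.2,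
            (vecQuat (((V (Site.shift a.1.1 a.1.2, ν) * (V (Site.shift a.1.1 ν, a.1.2))⁻¹ * (V (a.1.1, ν))⁻¹)⁻¹ : (Matrix.specialUnitaryGroup (Fin 2) ℂ)) : Matrix (Fin 2) (Fin 2) ℂ) +
              vecQuat ((((V (Site.shift (a.1.1 - Pi.single ν 1) a.1.2, ν))⁻¹ * (V (a.1.1 - Pi.single ν 1, a.1.2))⁻¹ *
                V (a.1.1 - Pi.single ν 1, ν))⁻¹ : (Matrix.specialUnitaryGroup (Fin 2) ℂ)) : Matrix (Fin 2) (Fin 2) ℂ))) (vecQuat ((V a.1 : (Matrix.specialUnitaryGroup (Fin 2) ℂ)) : Matrix (Fin 2) (Fin 2) ℂ)))) ^ 3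
          else kickJac (ε * ‖(∑ ν ∈ Finset.univ.erase a.1.2,
            (vecQuat (((V (Site.shift a.1.1 a.1.2, ν) * (V (Site.shift a.1.1 ν, a.1.2))⁻¹ * (V (a.1.1, ν))⁻¹)⁻¹ : (Matrix.specialUnitaryGroup (Fin 2) ℂ)) : Matrix (Fin 2) (Fin 2) ℂ) +
              vecQuat ((((V (Site.shift (a.1.1 - Pi.single ν 1) a.1.2, ν))⁻¹ * (V (a.1.1 - Pi.single ν 1, a.1.2))⁻¹ *
                V (a.1.1 - Pi.single ν 1, ν))⁻¹ : (Matrix.specialUnitaryGroup (Fin 2) ℂ)) : Matrix (Fin 2) (Fin 2) ℂ)))‖) 2 (angle (∑ ν ∈ Finset.univ.erase a.1.2,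
            (vecQuat (((V (Site.shift a.1.1 a.1.2, ν) * (V (Site.shift a.1.1 ν, a.1.2))⁻¹ * (V (a.1.1, ν))⁻¹)⁻¹ : (Matrix.specialUnitaryGroup (Fin 2) ℂ)) : Matrix (Fin 2) (Fin 2) ℂ) +
              vecQuat ((((V (Site.shift (a.1.1 - Pi.single ν 1) a.1.2, ν))⁻¹ * (V (a.1.1 - Pi.single ν 1, a.1.2))⁻¹ *
                V (a.1.1 - Pi.single ν 1, ν))⁻¹ : (Matrix.specialUnitaryGroup (Fin 2) ℂ)) : Matrix (Fin 2) (Fin 2) ℂ))) (vecQuat ((V a.1 : (Matrix.specialUnitaryGroup (Fin 2) ℂ)) : Matrix (Fin 2) (Fin 2) ℂ)))))) ∧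
      ∃ hΦ : Measurable (fun (V : GaugeConfig d L (Matrix.specialUnitaryGroup (Fin 2) ℂ)) (l : Edge d L) => κ • WithLp.toLp 2 (fun i : Fin 3 =>
        fderiv ℝ (fun a : Edge d L → EuclideanSpace ℝ (Fin 3) => β * wilsonAction (Matrix.specialUnitaryGroup (Fin 2) ℂ).subtype ((layers.foldr (fun Ly (F : GaugeConfig d L (Matrix.specialUnitaryGroup (Fin 2) ℂ) ≃ᵐ GaugeConfig d L (Matrix.specialUnitaryGroup (Fin 2) ℂ)) => Ly.1.trans F) (MeasurableEquiv.refl (GaugeConfig d L (Matrix.specialUnitaryGroup (Fin 2) ℂ)))) ((fun l : Edge d L => expPauli (a l)) * V)) - Real.log ((layers.foldr (fun Ly K => fun v => Ly.2 v * K (Ly.1 v)) (fun _ => (1 : ℝ))) ((fun l : Edge d L => expPauli (a l)) * V))) 0 (Pi.single l (EuclideanSpace.single i (1 : ℝ))))),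
      ∀ (n : ℕ) (ε' : ℝ) (_hn : 1 ≤ n) (_hε' : 0 < ε'), n * ε' ≤ τ₀ →
        ∃ k : ℕ, ∃ δ : ℝ, 0 < δ ∧ δ ≤ 1 ∧ ∀ (μ₀ : Measure (GaugeConfig d L (Matrix.specialUnitaryGroup (Fin 2) ℂ))) [IsProbabilityMeasure μ₀] (t : ℕ) (A : Set (GaugeConfig d L (Matrix.specialUnitaryGroup (Fin 2) ℂ))),
          |((fun m : Measure (GaugeConfig d L (Matrix.specialUnitaryGroup (Fin 2) ℂ)) =>
                m.bind (conjKernel (su2LeapfrogHMCN ε' κ' (measurable_halfKick_su2 hΦ ε')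
                  (fun V : GaugeConfig d L (Matrix.specialUnitaryGroup (Fin 2) ℂ) => β * wilsonAction (Matrix.specialUnitaryGroup (Fin 2) ℂ).subtype ((layers.foldr (fun Ly (F : GaugeConfig d L (Matrix.specialUnitaryGroup (Fin 2) ℂ) ≃ᵐ GaugeConfig d L (Matrix.specialUnitaryGroup (Fin 2) ℂ)) => Ly.1.trans F) (MeasurableEquiv.refl (GaugeConfig d L (Matrix.specialUnitaryGroup (Fin 2) ℂ)))) V) - Real.log ((layers.foldr (fun Ly K => fun v => Ly.2 v * K (Ly.1 v)) (fun _ => (1 : ℝ))) V)) n) (layers.foldr (fun Ly (F : GaugeConfig d L (Matrix.specialUnitaryGroup (Fin 2) ℂ) ≃ᵐ GaugeConfig d L (Matrix.specialUnitaryGroup (Fin 2) ℂ)) => Ly.1.trans F) (MeasurableEquiv.refl (GaugeConfig d L (Matrix.specialUnitaryGroup (Fin 2) ℂ))))))^[t] μ₀).real A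
            - (wilsonMeasure (Matrix.specialUnitaryGroup (Fin 2) ℂ).subtype β).real A| ≤ (1 - δ) ^ (t / (k + 1)) := by
  haveI : Fact (1 < 2) := ⟨by norm_num⟩
  obtain ⟨τ₀, hτ₀, h⟩ := su2WilsonFlowLO_member_fthmcN_exactForce_uniformlyErgodic_allVolumes (d := d) 2 hε
    ((List.replicate nsweeps ((List.finRange d).flatMap fun μ : Fin d => [(μ, (0 : ZMod 2)), (μ, 1)])).flatten) β κ hκ'
  refine ⟨τ₀, hτ₀, fun L _ hwL => ?_⟩
  exact h L hwL

end Parity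

end Summit.Ventures.LatticeQCDFlow.Exactness
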